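import Summits.BirchSwinnertonDyer.BirchSwinnertonDyer.Theorems.EisensteinPrimesBSDpOnCellCTelescopeBranchCofreeRealisation
import Literature.GroupTheory.Abelian.CocyclicPruferUniqueness
import Mathlib.Data.ZMod.QuotientGroup
import HarnessLib

/-!
# [telescope — width x2-p2 g23, 2026-08-30] THE MODULE HALF OF «B-iso»: an INTEGRAL INTERTWINER `Q` with quasi-inverse `Q'`
# (`Q Q' = Q' Q = p^c · 1`) between two framed `ℤ_p`-representations `M₁, M₂` gives an ISOGENY `(ℚ_p/ℤ_p)ⁿ → (ℚ_p/ℤ_p)ⁿ`, `v ↦ Q v`: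
# `ℤ_p`-linear, intertwining `M₂` with `M₁`, kernel inside the FINITE `p^c`-torsion, SURJECTIVE — the `e₀`/`e` of leaf N1♭
# Crux 4 `BSDpOnCellC` (stmt-BirchSwinnertonDyer-19034), line «telescope», leaf N1 `stub_branchLattice` (`--supports`, helper; closes nothing)

WHY: the lattice-level core N1♭ of leaf N1 (`TelescopeBranchLatticeOfFramed.branchLattice_of_framed`, this seat's #3) asks, at `X = 0` and at
every member point `X = x_k`, for an ISOGENY of cofree modules `(Fin 2 → QpModZp p) →+ target` intertwining the specialised framed action
`v ↦ (Σ_j φ((ρ σ)ᵢⱼ) • v j)` with the target's Galois action, with finite kernel and cokernel. Print (Hida 1986 Thm. 2.1 (2.2c)) and the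
cell's fact text T-GAL (ideator bsd-idea-12 g41, `Cruxes/BSDpOnCellC/T-GAL-FACTTEXT.md`) give the fibres as RATIONAL CONJUGACY of matrix
representations; ideator g41's H2 `…TelescopeBranchIntegralIntertwiner.exists_integral_intertwiner` turns a rational conjugacy into an
INTEGRAL intertwiner `Q` with integral quasi-inverse `Q'`, `Q Q' = Q' Q = p^c • 1`, `M₁ g * Q = Q * M₂ g`. THIS FILE is the module half:
such a `Q` acts on `V = Fin n → ℚ_p/ℤ_p` as an isogeny. Composing with target identifications (`(ℚ_p/ℤ_p)² ≃ E[p^∞]` from a Tate-module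
basis; `≃ A_{g_k}†` under (rat_k)) then yields the `e₀`/`e` of N1♭.

CONTENT (namespace `…Theorems.TelescopeBranchIsogenyOfIntertwiner`; THEOREMS ONLY, every map produced as `∃`):
* §1 `exists_addMonoidHom_mulVec` — `v ↦ (Σ_j Qᵢⱼ • v j)` as an additive, `ℤ_p`-linear endomorphism of `V = Fin n → QpModZp p` (any `Q`).
* §2 `mulVec_intertwines` — `M₁ g * Q = Q * M₂ g ⟹ Q (M₂ g · v) = M₁ g · (Q v)` (sum actions; `TelescopeBranchCofreeRealisation.sum_mul_apply_smul`).
* §3 `finite_torsionBy_pow` — the `p^c`-torsion of `V` is finite (`ℚ_p/ℤ_p` cocyclic: `QpModZpCocyclic.mem_zmultiples_tgen_of_nsmul_eq_zero`,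
  `addOrderOf_tgen`); `smul_pow_eq_zero_of_mulVec_eq_zero` — `Q' Q = p^c • 1`, `Q v = 0 ⟹ p^c • v = 0`; hence `finite_ker`.
* §4 `exists_pow_smul_eq` — `V` is `p^c`-divisible (`QpModZp.pow_smul_tgen_add`); `surjective_of_mul_eq` — `Q Q' = p^c • 1 ⟹ v ↦ Q v` onto.
* §5 **`exists_isogeny_of_intertwiner`** — the package: `∃ e : V →+ V`, formula, `ℤ_p`-linear, finite kernel, surjective; and
  `finite_ker_comp_of_injective`, `range_comp_of_surjective` — composing with a target identification keeps finite kernel / full range.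

HONEST FRAMING: generic `ℤ_p`-module algebra on `(ℚ_p/ℤ_p)ⁿ`; no Galois representation is constructed or compared here; closes no registered
stub, no crux, no summit statement; BSD is proved for no curve by this file. No named fact, no definition, no instance, no `sorry`.
References (shape only): [cite: Hida1986, Thm. 2.1 (2.2c) (fibres of the big representation up to isogeny)]
[cite: Greenberg1989, §1 p. 98 ("A_p = V_p/T_p which as a group is just (ℚ_p/ℤ_p)^d")]
-/

set_option autoImplicit false
set_option linter.dupNamespace false

noncomputable section

open scoped Classical
open Finset
open Literature.NumberTheory.IwasawaTheory Literature.GroupTheory.Abelian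
  Summit.BirchSwinnertonDyer.BirchSwinnertonDyer.Theorems.TelescopeBranchCofreeRealisation

namespace Summit.BirchSwinnertonDyer.BirchSwinnertonDyer.Theorems.TelescopeBranchIsogenyOfIntertwiner

variable {p : ℕ} [Fact p.Prime] {n : ℕ}

/-! ## §1 `v ↦ Q v` on `V = (ℚ_p/ℤ_p)ⁿ` -/

/-- **The matrix action `v ↦ (Σ_j Qᵢⱼ • v j)` of `Q ∈ Mₙ(ℤ_p)` on `V = Fin n → ℚ_p/ℤ_p`** as an additive map, `ℤ_p`-linear
(`T ⊗ ℚ_p/ℤ_p` functorial in the lattice map `Q : T₂ → T₁`). [cite: Greenberg1989, §1 p. 98] -/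
theorem exists_addMonoidHom_mulVec (Q : Matrix (Fin n) (Fin n) ℤ_[p]) :
    ∃ e : (Fin n → QpModZp p) →+ (Fin n → QpModZp p),
      (∀ (v : Fin n → QpModZp p) (i : Fin n), e v i = ∑ j, Q i j • v j) ∧
      ∀ (c : ℤ_[p]) (v : Fin n → QpModZp p), e (c • v) = c • e v := by
  refine ⟨{ toFun := fun v i ↦ ∑ j, Q i j • v j,
             map_zero' := funext fun i ↦ by simp,
             map_add' := fun v w ↦ funext fun i ↦ by
               change ∑ j, Q i j • (v j + w j) = (∑ j, Q i j • v j) + ∑ j, Q i j • w j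
               simp_rw [smul_add, Finset.sum_add_distrib] }, fun v i ↦ rfl, fun c v ↦ funext fun i ↦ ?_⟩
  change ∑ j, Q i j • (c • v j) = c • ∑ j, Q i j • v j
  rw [Finset.smul_sum]
  exact Finset.sum_congr rfl fun j _ ↦ smul_comm (Q i j) c (v j)

/-! ## §2 Intertwining -/

/-- **`M₁ g * Q = Q * M₂ g ⟹ Q (M₂ g · v) = M₁ g · (Q v)`** for the sum actions on `V`: the lattice map intertwines the two framed actions on
the cofree modules. [cite: Hida1986, Thm. 2.1 (2.2c)] -/
theorem mulVec_intertwines {G : Type*} (M₁ M₂ : G → Matrix (Fin n) (Fin n) ℤ_[p]) (Q : Matrix (Fin n) (Fin n) ℤ_[p])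
    (hQ : ∀ g, M₁ g * Q = Q * M₂ g) (e : (Fin n → QpModZp p) →+ (Fin n → QpModZp p))
    (he : ∀ (v : Fin n → QpModZp p) (i : Fin n), e v i = ∑ j, Q i j • v j) (g : G) (v : Fin n → QpModZp p) :
    e (fun i ↦ ∑ j, M₂ g i j • v j) = fun i ↦ ∑ j, M₁ g i j • e v j := by
  funext i
  rw [he]
  have h1 : ∑ j, Q i j • ∑ k, M₂ g j k • v k = ∑ k, (Q * M₂ g) i k • v k := (sum_mul_apply_smul Q (M₂ g) v i).symm
  have h2 : ∑ j, M₁ g i j • e v j = ∑ j, M₁ g i j • ∑ k, Q j k • v k :=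
    Finset.sum_congr rfl fun j _ ↦ by rw [show e v j = ∑ k, Q j k • v k from he v j]
  rw [h1, h2, ← sum_mul_apply_smul (M₁ g) Q v i, hQ]

/-! ## §3 Finite kernel -/

/-- The `p^c`-torsion of `ℚ_p/ℤ_p` is finite (inside the finite cyclic group `⟨p^{-c}⟩`). [cite: Greenberg1989, §1 p. 98] -/
theorem finite_setOf_pow_smul_eq_zero (c : ℕ) : {q : QpModZp p | (p : ℤ_[p]) ^ c • q = 0}.Finite := by
  have hfin : IsOfFinAddOrder (QpModZp.tgen p c) :=
    addOrderOf_pos_iff.mp (by rw [QpModZpCocyclic.addOrderOf_tgen]; exact pow_pos (Fact.out : p.Prime).pos c)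
  refine hfin.finite_zmultiples.subset fun q hq ↦ ?_
  rw [Set.mem_setOf_eq, QpModZpCocyclic.coe_pow_smul_eq_nsmul] at hq
  exact QpModZpCocyclic.mem_zmultiples_tgen_of_nsmul_eq_zero hq

/-- **The `p^c`-torsion of `V = (ℚ_p/ℤ_p)ⁿ` is finite.** [cite: Greenberg1989, §1 p. 98] -/
theorem finite_setOf_pow_smul_eq_zero_pi (c : ℕ) : {v : Fin n → QpModZp p | (p : ℤ_[p]) ^ c • v = 0}.Finite := by
  haveI : Finite {q : QpModZp p | (p : ℤ_[p]) ^ c • q = 0} := (finite_setOf_pow_smul_eq_zero c).to_subtype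
  refine Set.finite_coe_iff.mp (Finite.of_injective
    (fun v : {v : Fin n → QpModZp p | (p : ℤ_[p]) ^ c • v = 0} ↦ fun i ↦
      (⟨v.1 i, by have := congr_fun v.2 i; rwa [Pi.smul_apply, Pi.zero_apply] at this⟩ :
        {q : QpModZp p | (p : ℤ_[p]) ^ c • q = 0})) fun v w hvw ↦ ?_)
  apply Subtype.ext
  funext i
  have h := congrArg (fun f ↦ ((f i : {q : QpModZp p | (p : ℤ_[p]) ^ c • q = 0}) : QpModZp p)) hvw
  exact h

/-- `Q' Q = p^c • 1` and `Q v = 0` force `p^c • v = 0`. [cite: Hida1986, Thm. 2.1 (2.2c)] -/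
theorem pow_smul_eq_zero_of_mulVec_eq_zero (Q Q' : Matrix (Fin n) (Fin n) ℤ_[p]) {c : ℕ}
    (hQ'Q : Q' * Q = (p : ℤ_[p]) ^ c • (1 : Matrix (Fin n) (Fin n) ℤ_[p]))
    (e : (Fin n → QpModZp p) →+ (Fin n → QpModZp p)) (he : ∀ (v : Fin n → QpModZp p) (i : Fin n), e v i = ∑ j, Q i j • v j)
    {v : Fin n → QpModZp p} (hv : e v = 0) : (p : ℤ_[p]) ^ c • v = 0 := by
  funext i
  have h1 : ∑ j, Q' i j • e v j = 0 := by simp [hv]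
  have h2 : ∑ j, Q' i j • e v j = ∑ k, (Q' * Q) i k • v k := by
    rw [sum_mul_apply_smul]
    exact Finset.sum_congr rfl fun j _ ↦ by rw [he]
  rw [h2, hQ'Q] at h1
  simp_rw [Matrix.smul_apply, Matrix.one_apply, smul_ite, smul_eq_mul, mul_one, mul_zero, ite_smul, zero_smul,
    Finset.sum_ite_eq, Finset.mem_univ, if_true] at h1
  rw [Pi.smul_apply, Pi.zero_apply, h1]

/-- **Finite kernel**: with a left quasi-inverse `Q' Q = p^c • 1`, `ker (v ↦ Q v) ⊆ V[p^c]` is finite. [cite: Hida1986, Thm. 2.1 (2.2c)] -/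
theorem finite_ker (Q Q' : Matrix (Fin n) (Fin n) ℤ_[p]) {c : ℕ}
    (hQ'Q : Q' * Q = (p : ℤ_[p]) ^ c • (1 : Matrix (Fin n) (Fin n) ℤ_[p]))
    (e : (Fin n → QpModZp p) →+ (Fin n → QpModZp p)) (he : ∀ (v : Fin n → QpModZp p) (i : Fin n), e v i = ∑ j, Q i j • v j) :
    Finite e.ker := by
  haveI : Finite {v : Fin n → QpModZp p | (p : ℤ_[p]) ^ c • v = 0} := (finite_setOf_pow_smul_eq_zero_pi c).to_subtype
  refine Finite.of_injective (fun v : e.ker ↦ (⟨v.1, ?_⟩ : {v : Fin n → QpModZp p | (p : ℤ_[p]) ^ c • v = 0}))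
    fun v w hvw ↦ Subtype.ext (congrArg (fun x : {v : Fin n → QpModZp p | (p : ℤ_[p]) ^ c • v = 0} ↦ (x : Fin n → QpModZp p)) hvw)
  exact pow_smul_eq_zero_of_mulVec_eq_zero Q Q' hQ'Q e he ((AddMonoidHom.mem_ker).mp v.2)

/-! ## §4 Surjectivity -/

/-- `V = (ℚ_p/ℤ_p)ⁿ` is `p^c`-divisible. [cite: Greenberg1989, §1 p. 98] -/
theorem exists_pow_smul_eq (c : ℕ) (w : Fin n → QpModZp p) : ∃ u : Fin n → QpModZp p, (p : ℤ_[p]) ^ c • u = w := by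
  choose m u hu using fun i ↦ QpModZp.exists_eq_smul_tgen (w i)
  refine ⟨fun i ↦ u i • QpModZp.tgen p (m i + c), funext fun i ↦ ?_⟩
  rw [Pi.smul_apply, smul_comm, QpModZp.pow_smul_tgen_add, hu]

/-- **Surjective**: with a right quasi-inverse `Q Q' = p^c • 1`, `v ↦ Q v` is onto (`Q (Q' u) = p^c • u` and `V` is `p^c`-divisible).
[cite: Hida1986, Thm. 2.1 (2.2c)] -/
theorem surjective_of_mul_eq (Q Q' : Matrix (Fin n) (Fin n) ℤ_[p]) {c : ℕ}
    (hQQ' : Q * Q' = (p : ℤ_[p]) ^ c • (1 : Matrix (Fin n) (Fin n) ℤ_[p]))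
    (e : (Fin n → QpModZp p) →+ (Fin n → QpModZp p)) (he : ∀ (v : Fin n → QpModZp p) (i : Fin n), e v i = ∑ j, Q i j • v j) :
    Function.Surjective e := by
  intro w
  obtain ⟨u, rfl⟩ := exists_pow_smul_eq c w
  refine ⟨fun j ↦ ∑ k, Q' j k • u k, funext fun i ↦ ?_⟩
  rw [he, ← sum_mul_apply_smul, hQQ']
  simp_rw [Matrix.smul_apply, Matrix.one_apply, smul_ite, smul_eq_mul, mul_one, mul_zero, ite_smul, zero_smul,
    Finset.sum_ite_eq, Finset.mem_univ, if_true, Pi.smul_apply]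

/-! ## §5 The package and composition with a target isogeny -/

/-- **The isogeny of an integral intertwiner with quasi-inverse** (`Q Q' = Q' Q = p^c • 1`): an additive, `ℤ_p`-linear `e : V → V`,
`e v i = Σ_j Qᵢⱼ • v j`, with FINITE kernel and SURJECTIVE — the `e₀`/`e` of leaf N1♭ up to the target identification; with `mulVec_intertwines`
it intertwines `M₂` with `M₁` whenever `M₁ g * Q = Q * M₂ g`. [cite: Hida1986, Thm. 2.1 (2.2c)] [cite: Greenberg1989, §1 p. 98] -/
theorem exists_isogeny_of_intertwiner (Q Q' : Matrix (Fin n) (Fin n) ℤ_[p]) {c : ℕ}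
    (hQQ' : Q * Q' = (p : ℤ_[p]) ^ c • (1 : Matrix (Fin n) (Fin n) ℤ_[p]))
    (hQ'Q : Q' * Q = (p : ℤ_[p]) ^ c • (1 : Matrix (Fin n) (Fin n) ℤ_[p])) :
    ∃ e : (Fin n → QpModZp p) →+ (Fin n → QpModZp p),
      (∀ (v : Fin n → QpModZp p) (i : Fin n), e v i = ∑ j, Q i j • v j) ∧
      (∀ (c : ℤ_[p]) (v : Fin n → QpModZp p), e (c • v) = c • e v) ∧
      Finite e.ker ∧ Function.Surjective e := by
  obtain ⟨e, he, hlin⟩ := exists_addMonoidHom_mulVec (p := p) Q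
  exact ⟨e, he, hlin, finite_ker Q Q' hQ'Q e he, surjective_of_mul_eq Q Q' hQQ' e he⟩

/-- **Composition with an INJECTIVE target map keeps the kernel finite**: `ker (t ∘ e) = ker e` embeds in `ker e`. (The target identifications
of N1♭ — `(ℚ_p/ℤ_p)² ≃ E[p^∞]` from a Tate-module basis, `≃ A_{g_k}†` under (rat_k) — are bijections.) [folklore] -/
theorem finite_ker_comp_of_injective {A B C : Type*} [AddCommGroup A] [AddCommGroup B] [AddCommGroup C] (e : A →+ B) (t : B →+ C)
    (he : Finite e.ker) (ht : Function.Injective t) : Finite (t.comp e).ker := by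
  refine Finite.of_injective (fun a : (t.comp e).ker ↦ (⟨a.1, ?_⟩ : e.ker)) fun a b hab ↦
    Subtype.ext (congrArg (fun x : e.ker ↦ (x : A)) hab)
  have h := a.2
  rw [AddMonoidHom.mem_ker, AddMonoidHom.comp_apply, ← map_zero t] at h
  exact (AddMonoidHom.mem_ker).mpr (ht h)

/-- **Composition with a surjective isogeny keeps the range**: `range (t ∘ e) = range t` when `e` is onto. [folklore] -/
theorem range_comp_of_surjective {A B C : Type*} [AddCommGroup A] [AddCommGroup B] [AddCommGroup C] (e : A →+ B) (t : B →+ C)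
    (he : Function.Surjective e) : (t.comp e).range = t.range := by
  refine le_antisymm (fun c ⟨a, ha⟩ ↦ ⟨e a, ha⟩) fun c ⟨b, hb⟩ ↦ ?_
  obtain ⟨a, rfl⟩ := he b
  exact ⟨a, hb⟩

end Summit.BirchSwinnertonDyer.BirchSwinnertonDyer.Theorems.TelescopeBranchIsogenyOfIntertwiner

end
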